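import Literature.AlgebraicGeometry.AbelianSchemes.AbelianSchemeOverBase
import Literature.AlgebraicGeometry.Morphisms.SmoothOfFlatSurjectiveSmoothSource
import Literature.AlgebraicGeometry.Morphisms.GeometricallyConnectedOfSurjectiveComp
import Literature.AlgebraicGeometry.Resolution.SmoothDescentFlat
import Literature.RingTheory.Flat.FaithfullyFlatDescentFP
import Literature.AlgebraicGeometry.Dimension.SmoothFibreDimension
import Literature.AlgebraicGeometry.Motives.AbelianVarietyIsogenyProofs
import Literature.AlgebraicGeometry.Motives.AbelianVarietyProofs
import HarnessLib

/-!
# The target of a finite flat surjective morphism out of an abelian scheme is an abelian scheme of the same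
# relative dimension

Layer `Literature/AlgebraicGeometry/AbelianSchemes`, namespace `Literature.AlgebraicGeometry.AbelianSchemes`.
THEOREMS ONLY (no definition, no named fact, no instance).  Cell hodgecm-mathlib, crux hLiu418, line P6b №1
`MumfordDualFlat` §Q «quotient of an abelian scheme by a finite flat closed subgroup scheme» — organ Q10 of the
§Q junction census (the LAST step of [MumfordAV1970] §12 Thm. 1 / [SGA3I] Exp. V Thm. 4.1: once the quotient
`π : A → A/Z` is constructed as a finite flat surjective morphism onto a separated `S`-scheme of finite type, the
target is again an abelian scheme, of the relative dimension of `A`).  Everything is stated over ABSTRACT hypotheses —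
an `S`-morphism `π : A.X ⟶ Q` in `Over S` out of an abelian scheme `A`, flat and surjective (finite where needed),
onto a separated `Q → S` locally of finite type — so that the junction hand packages `⟨Q, _, _, _⟩ : AbelianSchemeOver S`
inline; no object of the §Q construction and no group law on `Q` is used except in the final packaging lemma.

* `smooth_of_isAffineHom_flat_surjective_of_smooth_comp` — **smoothness descends along an AFFINE flat surjective
  morphism of finite presentation of the source, over ANY base** (EGA IV₄ 17.7.7 / Stacks 05B5 for `X → Y` affine):
  the scheme-level globalisation, through Mathlib's `HasRingHomProperty @Smooth RingHom.Smooth`, of the affine Tag 05B5 ★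
  `Resolution.smooth_of_faithfullyFlat_of_finitePresentation` (no perfectness of residue fields: geometric regularity of
  the fibres descends, Tag 05AX).  Contrast ★ `Morphisms.smooth_of_flat_surjective_of_smooth_comp` (any flat surjective
  `ψ`, but perfect residue fields).
* `isProper_hom_of_surjective` — **`Q → S` is proper**: separated and locally of finite type by hypothesis, universally
  closed because `A → S = π ≫ (Q → S)` is and `π` is surjective (Mathlib `UniversallyClosed.of_comp_surjective`; the
  template is ★ `RelativeSpec.ActionOver.universallyClosed_gluedDesc` / `isProper_gluedDesc` for constant groups).
* `smooth_hom_of_isFinite_flat_surjective` — **`Q → S` is smooth**, for `π` FINITE flat surjective, over any locally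
  Noetherian base (by the previous bullet); `smooth_hom_of_flat_surjective` — the variant for `π` merely flat surjective,
  when the residue fields of `S` under `Q` are perfect (★ `Morphisms.smooth_of_flat_surjective_of_smooth_comp`, census
  risk r5 — NOT needed by the package below).
* `geometricallyConnected_hom_of_surjective` — **`Q → S` has geometrically connected fibres** (★
  `Morphisms.geometricallyConnected_of_surjective_comp`).
* `smoothOfRelativeDimension_of_isFinite_surjective_comp` — **relative dimension passes to the target along a FINITE
  surjective morphism of the source**: `π : A → Q` finite surjective, `g : Q → S` smooth, `π ≫ g` smooth of relative
  dimension `n` ⟹ `g` smooth of relative dimension `n`.  (The constant-group template had `π` étale and used ★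
  `Morphisms.smoothOfRelativeDimension_of_comp_eq_of_etale`; a finite flat group scheme `Z` gives a finite flat, in
  general inseparable, `π`, so the argument here goes through FIBRE DIMENSIONS instead: the relative dimension of the
  smooth `g` near `q` is the dimension of the fibre `Q_s` near `q` (★ `Dimension.topologicalKrullDim_fiber_eq_of_smoothOfRelativeDimension`),
  which equals the dimension of its finite surjective cover inside `A_s` (★ `Motives.Scheme.topologicalKrullDim_eq_of_isFinite_of_surjective`,
  Stacks 0ECG), which is `n`.)  [GortzWedhorn2020] Prop. 12.12 / Lemma 6.26; [Grothendieck1967] 17.10.2.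
* `smoothOfRelativeDimension_hom_of_isFinite_surjective` — the `Over S` spelling `SmoothOfRelativeDimension g Q.hom` from
  `A.IsOfRelDim g` (★ `AbelianSchemeOver.isOfRelDim_iff`), and
* `exists_abelianSchemeOver_of_isFinite_flat_surjective` — the def-free package, over ANY locally Noetherian base:
  given moreover a group-object structure on `Q`, `∃ hat : AbelianSchemeOver S, hat.X = Q ∧ ∀ g, A.IsOfRelDim g →
  hat.IsOfRelDim g` (the shape of the last two conjuncts of §Q `stub_L4B1uQ_quotientByFiniteFlatSubgroup`).

## References

* [MumfordAV1970] D. Mumford, *Abelian Varieties* (1970), §12 Thm. 1 (p. 111) (quotient `X/K` by a finite subgroup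
  scheme is an abelian variety, `X → X/K` an isogeny).
* [SGA3I] M. Demazure, A. Grothendieck, *SGA 3*, Exp. V Thm. 4.1.
* [Grothendieck1967] A. Grothendieck, *EGA IV₄*, Prop. 17.7.7, 17.5.1, 17.10.2.
* [GortzWedhorn2020] U. Görtz, T. Wedhorn, *Algebraic Geometry I*, 2nd ed. (2020), Lemma 6.26, Prop. 12.12.
* [StacksProject] Tag 05B5 (descent of smoothness along flat surjective l.f.p. morphisms), Tag 05AX, Tag 0ECG
  (Lemma 29.45.9), Tag 03GN (Lemma 29.42.9: universally closed, 2-out-of-3 with a surjection), Tag 0387.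
-/

noncomputable section

universe u

open CategoryTheory CategoryTheory.Limits AlgebraicGeometry TopologicalSpace

namespace Literature.AlgebraicGeometry.AbelianSchemes

/-! ## §1 Relative dimension along a finite surjective morphism of the source -/

section RelDim

/-- **Relative dimension passes to the target along a finite surjective morphism of the source.**  If `π : A → Q` is
finite and surjective, `g : Q → S` is smooth, and `π ≫ g : A → S` is smooth of relative dimension `n`, then `g` is smooth
of relative dimension `n`.  Proof: the relative dimension `m` of `g` on a small open `V ∋ q` (★
`exists_opens_smoothOfRelativeDimension_of_smooth`) is the dimension of the non-empty fibre `V_s` (`s = g q`), which is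
finitely and surjectively covered by the fibre `(π⁻¹V)_s` of `π⁻¹V → S`, of dimension `n`; finite surjective morphisms
preserve dimension (Stacks 0ECG), so `m = n`. [cite: GortzWedhorn2020, Lemma 6.26 and Prop. 12.12]
[cite: StacksProject, Tag 0ECG (Lemma 29.45.9)] -/
theorem smoothOfRelativeDimension_of_isFinite_surjective_comp {A Q S : Scheme.{u}} (π : A ⟶ Q) (g : Q ⟶ S)
    [IsFinite π] [Surjective π] [Smooth g] (n : ℕ) [h : SmoothOfRelativeDimension n (π ≫ g)] :
    SmoothOfRelativeDimension n g := by
  have key : ∀ q : Q, ∃ V : Q.Opens, q ∈ V ∧ SmoothOfRelativeDimension n (V.ι ≫ g) := by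
    intro q
    obtain ⟨V, m, hqV, hV⟩ := Motives.exists_opens_smoothOfRelativeDimension_of_smooth g q
    haveI := hV
    -- the restriction `ψ : π⁻¹ V → V` of `π` is finite surjective, and `ψ ≫ (V ↪ Q → S)` is smooth of rel. dim. `n`
    set f : (V : Scheme.{u}) ⟶ S := V.ι ≫ g with hf
    set ψ : (↑(π ⁻¹ᵁ V) : Scheme.{u}) ⟶ (V : Scheme.{u}) := π ∣_ V with hψ
    haveI : IsFinite ψ := IsZariskiLocalAtTarget.restrict (P := @IsFinite) inferInstance V
    haveI : Surjective ψ := IsZariskiLocalAtTarget.restrict (P := @Surjective) inferInstance V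
    have hψf : ψ ≫ f = (π ⁻¹ᵁ V).ι ≫ π ≫ g := by
      rw [hf, hψ, ← Category.assoc, morphismRestrict_ι, Category.assoc]
    haveI hn : SmoothOfRelativeDimension n (ψ ≫ f) := by
      rw [hψf]; exact IsZariskiLocalAtSource.comp h _
    -- the point `s = g q` and the two non-empty fibres over it
    set s : S := g q with hs
    have hqf : s ∈ Set.range f := ⟨⟨q, hqV⟩, by simp [hf, hs]⟩
    obtain ⟨a, ha⟩ := π.surjective q
    have haV : a ∈ π ⁻¹ᵁ V := by
      change π a ∈ V
      rw [ha]; exact hqV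
    have hqψf : s ∈ Set.range (ψ ≫ f) := ⟨⟨a, haV⟩, by simp [hψf, hs, ha]⟩
    haveI := Dimension.nonempty_fiber_of_mem_range f hqf
    haveI := Dimension.nonempty_fiber_of_mem_range (ψ ≫ f) hqψf
    have hdm : topologicalKrullDim (f.fiber s) = m :=
      Dimension.topologicalKrullDim_fiber_eq_of_smoothOfRelativeDimension f m s
    have hdn : topologicalKrullDim ((ψ ≫ f).fiber s) = n :=
      Dimension.topologicalKrullDim_fiber_eq_of_smoothOfRelativeDimension (ψ ≫ f) n s
    -- the fibre of `ψ ≫ f` is `π⁻¹V ×_V V_s`, finite surjective over `V_s` by the base change of `ψ`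
    -- (`Scheme.Hom.fiber` unfolded to the pullback along `ι = Spec κ(s) → S`)
    have hdm' : topologicalKrullDim ↥(pullback f (S.fromSpecResidueField s)) = m := hdm
    have hdn' : topologicalKrullDim ↥(pullback (ψ ≫ f) (S.fromSpecResidueField s)) = n := hdn
    have e : topologicalKrullDim ↥(pullback (ψ ≫ f) (S.fromSpecResidueField s)) =
        topologicalKrullDim ↥(pullback ψ (pullback.fst f (S.fromSpecResidueField s))) :=
      (IsHomeomorph.topologicalKrullDim_eq _
        (pullbackRightPullbackFstIso f (S.fromSpecResidueField s) ψ).hom.homeomorph.isHomeomorph).symm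
    have e' : topologicalKrullDim ↥(pullback ψ (pullback.fst f (S.fromSpecResidueField s))) =
        topologicalKrullDim ↥(pullback f (S.fromSpecResidueField s)) :=
      Motives.Scheme.topologicalKrullDim_eq_of_isFinite_of_surjective
        (pullback.snd ψ (pullback.fst f (S.fromSpecResidueField s)))
    have hmn : m = n := by
      have : (m : WithBot ℕ∞) = n := by rw [← hdm', ← e', ← e, hdn']
      exact_mod_cast this
    exact ⟨V, hqV, hmn ▸ hV⟩
  choose V hqV hV using key
  have hcov : iSup V = ⊤ := top_le_iff.mp fun x _ => Opens.mem_iSup.mpr ⟨x, hqV x⟩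
  exact IsZariskiLocalAtSource.of_iSup_eq_top (P := @SmoothOfRelativeDimension n) V hcov hV

/-- The same with the composite given as a named morphism `f = π ≫ g` (the shape of an `Over`-triangle `Over.w π`).
[cite: GortzWedhorn2020, Lemma 6.26 and Prop. 12.12] -/
theorem smoothOfRelativeDimension_of_isFinite_surjective_comp_eq {A Q S : Scheme.{u}} (π : A ⟶ Q) (g : Q ⟶ S)
    (f : A ⟶ S) (hf : π ≫ g = f) [IsFinite π] [Surjective π] [Smooth g] (n : ℕ)
    [SmoothOfRelativeDimension n f] : SmoothOfRelativeDimension n g := by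
  subst hf
  exact smoothOfRelativeDimension_of_isFinite_surjective_comp π g n

end RelDim

/-! ## §2 Smoothness descends along an AFFINE flat surjective morphism of the source (no perfectness) -/

section SmoothDescent

/-- **Smoothness descends along an affine, flat, surjective morphism of finite presentation of the source — over ANY
base** (EGA IV₄ 17.7.7 / Stacks 05B5 «if `X → Y` is surjective, flat, locally of finite presentation and `X → S` is
smooth then `Y → S` is smooth», for `X → Y` affine): `ψ : A → Q` affine (e.g. finite), flat, surjective, locally of finite
presentation, `g : Q → S` locally of finite presentation, `ψ ≫ g` smooth ⟹ `g` smooth.  No hypothesis on the residue fields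
of `S` (contrast ★ `Morphisms.smooth_of_flat_surjective_of_smooth_comp`, which asks them perfect): affine-locally, for affine
opens `V ⊆ Q` over `U ⊆ S`, the ring maps `Γ(S, U) → Γ(Q, V) → Γ(A, ψ⁻¹V)` have `Γ(Q, V) → Γ(A, ψ⁻¹V)` faithfully flat of finite
presentation (`ψ⁻¹V` is affine and `ψ⁻¹V → V` is flat surjective, Mathlib `Flat.flat_and_surjective_iff_faithfullyFlat_of_isAffine`)
and `Γ(S, U) → Γ(A, ψ⁻¹V)` smooth, so `Γ(S, U) → Γ(Q, V)` is smooth by the affine Tag 05B5 ★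
`Resolution.smooth_of_faithfullyFlat_of_finitePresentation` (flatness by 02JZ, the fibrewise criterion 01V8/00TF and the
field case 05AX — geometric regularity descends, no perfectness needed). [cite: StacksProject, Tag 05B5]
[cite: Grothendieck1967, Prop. 17.7.7] -/
theorem smooth_of_isAffineHom_flat_surjective_of_smooth_comp {A Q S : Scheme.{u}} (ψ : A ⟶ Q) (g : Q ⟶ S)
    [IsAffineHom ψ] [Flat ψ] [Surjective ψ] [LocallyOfFinitePresentation ψ] [LocallyOfFinitePresentation g]
    [Smooth (ψ ≫ g)] : Smooth g := by
  rw [HasRingHomProperty.iff_appLE (P := @Smooth)]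
  intro U V e
  -- the affine open `W = ψ⁻¹ V` of `A`
  have hW : IsAffineOpen (ψ ⁻¹ᵁ (V : Q.Opens)) := V.2.preimage ψ
  let W : A.affineOpens := ⟨ψ ⁻¹ᵁ (V : Q.Opens), hW⟩
  have eW : (W : A.Opens) ≤ ψ ⁻¹ᵁ (V : Q.Opens) := le_rfl
  -- `Γ(S,U) → Γ(Q,V)` and `Γ(Q,V) → Γ(A,W)` are of finite presentation; `Γ(S,U) → Γ(A,W)` is smooth
  have h1 : (g.appLE U V e).hom.FinitePresentation :=
    HasRingHomProperty.appLE (P := @LocallyOfFinitePresentation) _ inferInstance U V e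
  have h2 : (ψ.appLE V W eW).hom.FinitePresentation :=
    HasRingHomProperty.appLE (P := @LocallyOfFinitePresentation) _ inferInstance V W eW
  have h3 : ((ψ ≫ g).appLE U W (eW.trans ((Opens.map ψ.base).map (homOfLE e)).le)).hom.Smooth :=
    HasRingHomProperty.appLE (P := @Smooth) _ inferInstance U W _
  rw [← Scheme.Hom.appLE_comp_appLE ψ g U V W e eW, CommRingCat.hom_comp] at h3
  -- `Γ(Q,V) → Γ(A,W)` is faithfully flat: `W = ψ⁻¹V → V` is a flat surjective morphism of affine schemes
  have h4 : (ψ.appLE V W eW).hom.FaithfullyFlat := by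
    haveI : IsAffine (V : Q.Opens).toScheme := V.2
    haveI : IsAffine (W : A.Opens).toScheme := hW
    have hres : ψ.resLE V W eW = ψ ∣_ (V : Q.Opens) := Scheme.Hom.resLE_eq_morphismRestrict ψ
    haveI : Surjective (ψ.resLE V W eW) := by
      rw [hres]; exact IsZariskiLocalAtTarget.restrict (P := @Surjective) inferInstance _
    have hff : (ψ.resLE V W eW).appTop.hom.FaithfullyFlat :=
      (Flat.flat_and_surjective_iff_faithfullyFlat_of_isAffine (ψ.resLE V W eW)).mp ⟨inferInstance, inferInstance⟩
    haveI : (RingHom.toMorphismProperty RingHom.FaithfullyFlat).RespectsIso :=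
      RingHom.toMorphismProperty_respectsIso_iff.mp RingHom.FaithfullyFlat.respectsIso
    exact (MorphismProperty.arrow_mk_iso_iff (RingHom.toMorphismProperty RingHom.FaithfullyFlat)
      (arrowResLEAppIso ψ V W eW)).mp hff
  -- Tag 05B5 (affine) for `Γ(S,U) → Γ(Q,V) → Γ(A,W)`
  algebraize [(g.appLE U V e).hom, (ψ.appLE V W eW).hom, (ψ.appLE V W eW).hom.comp (g.appLE U V e).hom]
  exact Resolution.smooth_of_faithfullyFlat_of_finitePresentation Γ(S, U) Γ(Q, V) Γ(A, W)

end SmoothDescent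

/-! ## §3 The target of a flat surjective `S`-morphism out of an abelian scheme -/

section Target

variable {S : Scheme.{u}} (A : AbelianSchemeOver S) {Q : Over S} (π : A.X ⟶ Q)

/-- **`Q → S` is proper** if it is separated and locally of finite type and receives a surjective `S`-morphism from an
abelian scheme: universally closed by two-out-of-three along the surjection `π` (`A → S = π ≫ (Q → S)` is proper).
[cite: StacksProject, Tag 03GN (Lemma 29.42.9)] [cite: MumfordAV1970, §12 Thm. 1 (p. 111)] -/
theorem isProper_hom_of_surjective [Surjective π.left] [IsSeparated Q.hom] [LocallyOfFiniteType Q.hom] :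
    IsProper Q.hom := by
  haveI := A.isProper
  haveI : UniversallyClosed (π.left ≫ Q.hom) := by rw [Over.w π]; infer_instance
  haveI : UniversallyClosed Q.hom := UniversallyClosed.of_comp_surjective π.left Q.hom
  exact {}

/-- **`Q → S` is smooth** if it is locally of finite type over a locally Noetherian base whose residue fields under `Q`
are perfect, and receives a flat surjective `S`-morphism from an abelian scheme (EGA IV₄ 17.7.7: smoothness descends
along a flat surjection of the source, fibrewise via regularity ★ `Morphisms.smooth_of_flat_surjective_of_smooth_comp`).
[cite: Grothendieck1967, Prop. 17.5.1 and Prop. 17.7.7] [cite: MumfordAV1970, §12 Thm. 1 (p. 111)] -/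
theorem smooth_hom_of_flat_surjective [Flat π.left] [Surjective π.left] [LocallyOfFiniteType Q.hom]
    [IsLocallyNoetherian S] (hperf : ∀ q : ↥Q.left, PerfectField (S.residueField (Q.hom q))) :
    Smooth Q.hom := by
  haveI := A.isSmooth
  exact Morphisms.smooth_of_flat_surjective_of_smooth_comp π.left Q.hom A.X.hom (Over.w π) hperf

/-- **`Q → S` is smooth — no hypothesis on residue fields** — if it is locally of finite type over a locally Noetherian base
and receives a FINITE flat surjective `S`-morphism from an abelian scheme (`smooth_of_isAffineHom_flat_surjective_of_smooth_comp`: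
`π` is affine, and locally of finite presentation because `Q` is locally Noetherian).  This is the form the §Q junction
consumes (its `π : A → A/Z` is finite flat surjective), over an arbitrary Noetherian base. [cite: StacksProject, Tag 05B5]
[cite: MumfordAV1970, §12 Thm. 1 (p. 111)] -/
theorem smooth_hom_of_isFinite_flat_surjective [IsFinite π.left] [Flat π.left] [Surjective π.left]
    [LocallyOfFiniteType Q.hom] [IsLocallyNoetherian S] : Smooth Q.hom := by
  haveI := A.isSmooth
  haveI : IsLocallyNoetherian Q.left := LocallyOfFiniteType.isLocallyNoetherian Q.hom
  haveI : Smooth (π.left ≫ Q.hom) := by rw [Over.w π]; infer_instance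
  exact smooth_of_isAffineHom_flat_surjective_of_smooth_comp π.left Q.hom

/-- **`Q → S` has geometrically connected fibres** if it receives a surjective `S`-morphism from an abelian scheme
(★ `Morphisms.geometricallyConnected_of_surjective_comp`). [cite: StacksProject, Tag 0387]
[cite: MumfordAV1970, §12 Thm. 1 (p. 111)] -/
theorem geometricallyConnected_hom_of_surjective [Surjective π.left] : GeometricallyConnected Q.hom := by
  haveI : GeometricallyConnected (π.left ≫ Q.hom) := by rw [Over.w π]; exact A.geometricallyConnected
  exact Morphisms.geometricallyConnected_of_surjective_comp π.left Q.hom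

/-- **`Q → S` is smooth of relative dimension `g`** if `A` is (`A.IsOfRelDim g`), `Q → S` is smooth, and `π` is finite and
surjective (`smoothOfRelativeDimension_of_isFinite_surjective_comp`). [cite: GortzWedhorn2020, Lemma 6.26 and Prop. 12.12]
[cite: MumfordAV1970, §12 Thm. 1 (p. 111)] -/
theorem smoothOfRelativeDimension_hom_of_isFinite_surjective [IsFinite π.left] [Surjective π.left]
    (hQ : Smooth Q.hom) {g : ℕ} (hA : A.IsOfRelDim g) : SmoothOfRelativeDimension g Q.hom := by
  haveI := hQ
  haveI : SmoothOfRelativeDimension g A.X.hom := (A.isOfRelDim_iff g).mp hA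
  exact smoothOfRelativeDimension_of_isFinite_surjective_comp_eq π.left Q.hom A.X.hom (Over.w π) g

/-- **The def-free package** (the last two conjuncts of §Q, [MumfordAV1970] §12 Thm. 1: «`X/K` is an abelian variety of
the same dimension»).  If `Q` carries an `S`-group-scheme structure, `Q → S` is separated and locally of finite type over
a locally Noetherian `S` (NO hypothesis on residue fields), and `π : A.X → Q` is a finite flat surjective `S`-morphism out
of an abelian scheme `A`, then `Q` underlies an abelian scheme `hat` over `S` (with the GIVEN group law), of relative
dimension `g` whenever `A` is.  No homomorphy of `π` is needed here (that is organ Q8 of the census).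
[cite: MumfordAV1970, §12 Thm. 1 (p. 111)] [cite: SGA3I, Exp. V Thm. 4.1] -/
theorem exists_abelianSchemeOver_of_isFinite_flat_surjective [GrpObj Q] [IsFinite π.left] [Flat π.left]
    [Surjective π.left] [IsSeparated Q.hom] [LocallyOfFiniteType Q.hom] [IsLocallyNoetherian S] :
    ∃ hat : AbelianSchemeOver S, hat.X = Q ∧ ∀ g : ℕ, A.IsOfRelDim g → hat.IsOfRelDim g :=
  ⟨{ X := Q
     isProper := isProper_hom_of_surjective A π
     isSmooth := smooth_hom_of_isFinite_flat_surjective A π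
     geometricallyConnected := geometricallyConnected_hom_of_surjective A π }, rfl,
    fun _ hA => smoothOfRelativeDimension_hom_of_isFinite_surjective A π (smooth_hom_of_isFinite_flat_surjective A π) hA⟩

end Target

/-! ## §4 (ED. 2) Stacks 05B5 in full: smoothness descends along ANY flat surjective morphism of finite presentation of
the source; the target package for a flat surjective `π` of finite presentation -/

section SmoothDescentGeneral

/-- **Smoothness descends along a flat, surjective morphism locally of finite presentation of the source — over ANY base
and with NO affineness** (The Stacks Project, Tag 05B5: «Let `X → Y → S` … if `X → Y` is surjective, flat and locally of
finite presentation and `X → S` is smooth, then `Y → S` is smooth»; EGA IV₄ 17.7.7).  Reduction to the affine case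
`smooth_of_isAffineHom_flat_surjective_of_smooth_comp`: for `q ∈ Q` pick `a ∈ ψ⁻¹(q)` and affine opens `a ∈ U ⊆ ψ⁻¹V`,
`q ∈ V`; `ψ` is universally open (flat + locally of finite presentation, Mathlib `UniversallyOpen.of_flat`), so `W := ψ(U)`
is an open neighbourhood of `q`, and the co-restriction `U → W` of `ψ` is affine (cancel the separated `W ↪ V` from the
affine `U → V`), flat, surjective, locally of finite presentation, with `U → W ↪ Q → S` smooth; hence `W ↪ Q → S` is
smooth, and smoothness is Zariski-local on the source. [cite: StacksProject, Tag 05B5] [cite: Grothendieck1967, Prop. 17.7.7] -/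
theorem smooth_of_flat_surjective_locallyOfFinitePresentation_of_smooth_comp {A Q S : Scheme.{u}} (ψ : A ⟶ Q)
    (g : Q ⟶ S) [Flat ψ] [Surjective ψ] [LocallyOfFinitePresentation ψ] [LocallyOfFinitePresentation g]
    [Smooth (ψ ≫ g)] : Smooth g := by
  have key : ∀ q : Q, ∃ W : Q.Opens, q ∈ W ∧ Smooth (W.ι ≫ g) := by
    intro q
    obtain ⟨a, ha⟩ := ψ.surjective q
    -- affine opens `q ∈ V ⊆ Q` and `a ∈ U ⊆ ψ⁻¹ V`
    obtain ⟨_, ⟨V, hV, rfl⟩, hqV, -⟩ :=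
      Q.isBasis_affineOpens.exists_subset_of_mem_open (Set.mem_univ q) isOpen_univ
    have haV : a ∈ ψ ⁻¹ᵁ V := by
      change ψ a ∈ V
      rw [ha]; exact hqV
    obtain ⟨_, ⟨U, hU, rfl⟩, haU, hUV⟩ :=
      A.isBasis_affineOpens.exists_subset_of_mem_open haV (ψ ⁻¹ᵁ V).isOpen
    -- the open image `W := ψ(U) ∋ q`, inside `V`
    let W : Q.Opens := ⟨ψ '' (U : Set A), ψ.isOpenMap _ U.isOpen⟩
    have hqW : q ∈ W := ⟨a, haU, ha⟩
    have hWV : W ≤ V := by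
      rintro _ ⟨x, hx, rfl⟩
      exact hUV hx
    have hUW : U ≤ ψ ⁻¹ᵁ W := fun x hx => ⟨x, hx, rfl⟩
    -- the co-restriction `φ : U → W` of `ψ`
    haveI : IsAffine (U : Scheme.{u}) := hU
    haveI : IsAffine (V : Scheme.{u}) := hV
    let φ : (U : Scheme.{u}) ⟶ (W : Scheme.{u}) := ψ.resLE W U hUW
    haveI : LocallyOfFinitePresentation φ :=
      IsZariskiLocalAtSource.resLE (P := @LocallyOfFinitePresentation) hUW inferInstance
    haveI : Surjective φ := ⟨by
      rintro ⟨_, x, hx, rfl⟩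
      exact ⟨⟨x, hx⟩, Subtype.ext (Scheme.Hom.coe_resLE_apply ψ hUW ⟨x, hx⟩)⟩⟩
    haveI : IsAffineHom φ := by
      have hc : φ ≫ Q.homOfLE hWV = ψ.resLE V U hUV := Scheme.Hom.resLE_map ψ hUW hWV
      have h : IsAffineHom (φ ≫ Q.homOfLE hWV) := by rw [hc]; infer_instance
      exact MorphismProperty.of_postcomp (W := @IsAffineHom) (W' := @IsSeparated) φ (Q.homOfLE hWV) inferInstance h
    haveI : Smooth (φ ≫ W.ι ≫ g) := by
      rw [← Category.assoc, Scheme.Hom.resLE_comp_ι, Category.assoc]; infer_instance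
    exact ⟨W, hqW, smooth_of_isAffineHom_flat_surjective_of_smooth_comp φ (W.ι ≫ g)⟩
  choose W hqW hW using key
  have hcov : iSup W = ⊤ := top_le_iff.mp fun x _ => Opens.mem_iSup.mpr ⟨x, hqW x⟩
  exact IsZariskiLocalAtSource.of_iSup_eq_top (P := @Smooth) W hcov hW

/-- The same with the composite given as a named morphism `f = ψ ≫ g` (the shape of an `Over`-triangle `Over.w`).
[cite: StacksProject, Tag 05B5] -/
theorem smooth_of_flat_surjective_locallyOfFinitePresentation_of_smooth_comp_eq {A Q S : Scheme.{u}} (ψ : A ⟶ Q)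
    (g : Q ⟶ S) (f : A ⟶ S) (hf : ψ ≫ g = f) [Flat ψ] [Surjective ψ] [LocallyOfFinitePresentation ψ]
    [LocallyOfFinitePresentation g] [Smooth f] : Smooth g := by
  subst hf
  exact smooth_of_flat_surjective_locallyOfFinitePresentation_of_smooth_comp ψ g

variable {S : Scheme.{u}} (A : AbelianSchemeOver S) {Q : Over S} (π : A.X ⟶ Q)

/-- **`Q → S` is smooth — no hypothesis on residue fields, no finiteness of `π`** — if it is locally of finite type over a
locally Noetherian base and receives a flat surjective `S`-morphism (automatically locally of finite presentation, `Q` being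
locally Noetherian) from an abelian scheme (Tag 05B5, `smooth_of_flat_surjective_locallyOfFinitePresentation_of_smooth_comp`).
Supersedes the perfect-residue-field variant `smooth_hom_of_flat_surjective`. [cite: StacksProject, Tag 05B5]
[cite: MumfordAV1970, §12 Thm. 1 (p. 111)] -/
theorem smooth_hom_of_flat_surjective' [Flat π.left] [Surjective π.left] [LocallyOfFiniteType Q.hom]
    [IsLocallyNoetherian S] : Smooth Q.hom := by
  haveI := A.isSmooth
  haveI : IsLocallyNoetherian Q.left := LocallyOfFiniteType.isLocallyNoetherian Q.hom
  haveI : LocallyOfFiniteType (π.left ≫ Q.hom) := by rw [Over.w π]; infer_instance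
  haveI : LocallyOfFiniteType π.left := locallyOfFiniteType_of_comp π.left Q.hom
  haveI : Smooth (π.left ≫ Q.hom) := by rw [Over.w π]; infer_instance
  exact smooth_of_flat_surjective_locallyOfFinitePresentation_of_smooth_comp π.left Q.hom

end SmoothDescentGeneral

/-! ## §5 (ED. 3) Stacks 02KK at scheme level: finite presentation descends along a flat surjective morphism of finite
presentation of the source — and Tag 05B5 VERBATIM (no surplus `LocallyOfFinitePresentation g` binder) -/

section FinitePresentationDescent

/-- **Finite presentation descends along an AFFINE flat surjective morphism of finite presentation of the source** (Stacks 02KK,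
«`R → A → B`, `A → B` faithfully flat of finite presentation, `R → B` of finite presentation ⇒ `R → A` of finite presentation»,
globalised for `X → Y` affine): `ψ : A → Q` affine, flat, surjective, locally of finite presentation, `ψ ≫ g` locally of finite
presentation ⟹ `g` locally of finite presentation.  Affine-locally this is ★ `RingTheory.Flat.finitePresentation_of_faithfullyFlat_of_finitePresentation`
on `Γ(S, U) → Γ(Q, V) → Γ(A, ψ⁻¹V)`, exactly as in `smooth_of_isAffineHom_flat_surjective_of_smooth_comp`. [cite: StacksProject, Tag 02KK] -/
theorem locallyOfFinitePresentation_of_isAffineHom_flat_surjective_comp {A Q S : Scheme.{u}} (ψ : A ⟶ Q) (g : Q ⟶ S)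
    [IsAffineHom ψ] [Flat ψ] [Surjective ψ] [LocallyOfFinitePresentation ψ] [LocallyOfFinitePresentation (ψ ≫ g)] :
    LocallyOfFinitePresentation g := by
  rw [HasRingHomProperty.iff_appLE (P := @LocallyOfFinitePresentation)]
  intro U V e
  have hW : IsAffineOpen (ψ ⁻¹ᵁ (V : Q.Opens)) := V.2.preimage ψ
  let W : A.affineOpens := ⟨ψ ⁻¹ᵁ (V : Q.Opens), hW⟩
  have eW : (W : A.Opens) ≤ ψ ⁻¹ᵁ (V : Q.Opens) := le_rfl
  have h2 : (ψ.appLE V W eW).hom.FinitePresentation :=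
    HasRingHomProperty.appLE (P := @LocallyOfFinitePresentation) _ inferInstance V W eW
  have h3 : ((ψ ≫ g).appLE U W (eW.trans ((Opens.map ψ.base).map (homOfLE e)).le)).hom.FinitePresentation :=
    HasRingHomProperty.appLE (P := @LocallyOfFinitePresentation) _ inferInstance U W _
  rw [← Scheme.Hom.appLE_comp_appLE ψ g U V W e eW, CommRingCat.hom_comp] at h3
  have h4 : (ψ.appLE V W eW).hom.FaithfullyFlat := by
    haveI : IsAffine (V : Q.Opens).toScheme := V.2
    haveI : IsAffine (W : A.Opens).toScheme := hW
    have hres : ψ.resLE V W eW = ψ ∣_ (V : Q.Opens) := Scheme.Hom.resLE_eq_morphismRestrict ψ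
    haveI : Surjective (ψ.resLE V W eW) := by
      rw [hres]; exact IsZariskiLocalAtTarget.restrict (P := @Surjective) inferInstance _
    have hff : (ψ.resLE V W eW).appTop.hom.FaithfullyFlat :=
      (Flat.flat_and_surjective_iff_faithfullyFlat_of_isAffine (ψ.resLE V W eW)).mp ⟨inferInstance, inferInstance⟩
    haveI : (RingHom.toMorphismProperty RingHom.FaithfullyFlat).RespectsIso :=
      RingHom.toMorphismProperty_respectsIso_iff.mp RingHom.FaithfullyFlat.respectsIso
    exact (MorphismProperty.arrow_mk_iso_iff (RingHom.toMorphismProperty RingHom.FaithfullyFlat)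
      (arrowResLEAppIso ψ V W eW)).mp hff
  algebraize [(g.appLE U V e).hom, (ψ.appLE V W eW).hom, (ψ.appLE V W eW).hom.comp (g.appLE U V e).hom]
  exact Literature.RingTheory.Flat.finitePresentation_of_faithfullyFlat_of_finitePresentation Γ(S, U) Γ(Q, V) Γ(A, W)

/-- **Finite presentation descends along a flat, surjective morphism locally of finite presentation of the source** (Stacks 02KK at
scheme level, no affineness — the first step of the printed proof of Tag 05B5): `ψ : A → Q` flat surjective locally of finite
presentation, `ψ ≫ g` locally of finite presentation ⟹ `g` locally of finite presentation.  Reduction to the affine case along the open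
images `ψ(U)` of small affine opens, as in `smooth_of_flat_surjective_locallyOfFinitePresentation_of_smooth_comp`.
[cite: StacksProject, Tag 02KK] -/
theorem locallyOfFinitePresentation_of_flat_surjective_comp {A Q S : Scheme.{u}} (ψ : A ⟶ Q) (g : Q ⟶ S)
    [Flat ψ] [Surjective ψ] [LocallyOfFinitePresentation ψ] [LocallyOfFinitePresentation (ψ ≫ g)] :
    LocallyOfFinitePresentation g := by
  have key : ∀ q : Q, ∃ W : Q.Opens, q ∈ W ∧ LocallyOfFinitePresentation (W.ι ≫ g) := by
    intro q
    obtain ⟨a, ha⟩ := ψ.surjective q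
    obtain ⟨_, ⟨V, hV, rfl⟩, hqV, -⟩ :=
      Q.isBasis_affineOpens.exists_subset_of_mem_open (Set.mem_univ q) isOpen_univ
    have haV : a ∈ ψ ⁻¹ᵁ V := by
      change ψ a ∈ V
      rw [ha]; exact hqV
    obtain ⟨_, ⟨U, hU, rfl⟩, haU, hUV⟩ :=
      A.isBasis_affineOpens.exists_subset_of_mem_open haV (ψ ⁻¹ᵁ V).isOpen
    let W : Q.Opens := ⟨ψ '' (U : Set A), ψ.isOpenMap _ U.isOpen⟩
    have hqW : q ∈ W := ⟨a, haU, ha⟩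
    have hWV : W ≤ V := by
      rintro _ ⟨x, hx, rfl⟩
      exact hUV hx
    have hUW : U ≤ ψ ⁻¹ᵁ W := fun x hx => ⟨x, hx, rfl⟩
    haveI : IsAffine (U : Scheme.{u}) := hU
    haveI : IsAffine (V : Scheme.{u}) := hV
    let φ : (U : Scheme.{u}) ⟶ (W : Scheme.{u}) := ψ.resLE W U hUW
    haveI : LocallyOfFinitePresentation φ :=
      IsZariskiLocalAtSource.resLE (P := @LocallyOfFinitePresentation) hUW inferInstance
    haveI : Surjective φ := ⟨by
      rintro ⟨_, x, hx, rfl⟩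
      exact ⟨⟨x, hx⟩, Subtype.ext (Scheme.Hom.coe_resLE_apply ψ hUW ⟨x, hx⟩)⟩⟩
    haveI : IsAffineHom φ := by
      have hc : φ ≫ Q.homOfLE hWV = ψ.resLE V U hUV := Scheme.Hom.resLE_map ψ hUW hWV
      have h : IsAffineHom (φ ≫ Q.homOfLE hWV) := by rw [hc]; infer_instance
      exact MorphismProperty.of_postcomp (W := @IsAffineHom) (W' := @IsSeparated) φ (Q.homOfLE hWV) inferInstance h
    haveI : LocallyOfFinitePresentation (φ ≫ W.ι ≫ g) := by
      rw [← Category.assoc, Scheme.Hom.resLE_comp_ι, Category.assoc]; infer_instance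
    exact ⟨W, hqW, locallyOfFinitePresentation_of_isAffineHom_flat_surjective_comp φ (W.ι ≫ g)⟩
  choose W hqW hW using key
  have hcov : iSup W = ⊤ := top_le_iff.mp fun x _ => Opens.mem_iSup.mpr ⟨x, hqW x⟩
  exact IsZariskiLocalAtSource.of_iSup_eq_top (P := @LocallyOfFinitePresentation) W hcov hW

/-- **Stacks 05B5 verbatim**: `ψ : A → Q` flat, surjective, locally of finite presentation and `ψ ≫ g : A → S` smooth ⟹ `g : Q → S`
smooth — with NO finite-presentation hypothesis on `g` (it follows, `locallyOfFinitePresentation_of_flat_surjective_comp`) and no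
hypothesis on residue fields. [cite: StacksProject, Tag 05B5] [cite: Grothendieck1967, Prop. 17.7.7] -/
theorem smooth_of_flat_surjective_locallyOfFinitePresentation_of_smooth_comp' {A Q S : Scheme.{u}} (ψ : A ⟶ Q) (g : Q ⟶ S)
    [Flat ψ] [Surjective ψ] [LocallyOfFinitePresentation ψ] [Smooth (ψ ≫ g)] : Smooth g := by
  haveI : LocallyOfFinitePresentation g := locallyOfFinitePresentation_of_flat_surjective_comp ψ g
  exact smooth_of_flat_surjective_locallyOfFinitePresentation_of_smooth_comp ψ g

end FinitePresentationDescent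

end Literature.AlgebraicGeometry.AbelianSchemes

end
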